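import Summits.Schanuel.Schanuel.Theorems.RootDecomp1BChannelCountCore
import Literature.NumberTheory.Transcendental.GelfondSchneiderProofs
import Summits.Schanuel.Schanuel.Theorems.RoyCriterionRankOne

/-!
# RootDecomp1BChannelCount — part 4/4 (Cells): LAYER 0 OF TC IS A THEOREM (Hermite–Lindemann + GELFOND–SCHNEIDER), and one storey up

`atMostOne_algebraic_channel`: for a real `u ≠ 0` at most one of `u, e^u, e^{iu}` is algebraic — Hermite–Lindemann for the pairs through `u`,
Gelfond–Schneider (`a = e^u ∈ ℚ̄`, `b = i ∉ ℚ` ⟹ `a^b = e^{iu} ∉ ℚ̄`) for the pair `(e^u, e^{iu})`; inputs `transcendental_exp_holds` and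
`gelfond_schneider_holds`, both PROVED in the tree.  Hence `sharpSecondChannelAt_zero` (TC's storey 0, HYPOTHESIS-FREE — the bc5 rung of TC),
`channels_log_algebraic`, `twoChannelDefectZeroAt_zero_iff` / `sharpDefectZeroAt_zero_iff` (= X(1), open at `log 2`).  One storey up every TC-cell is an
honest two-of-three statement (`sharpSecondChannelAt_snoc_exp_iff`, `…_snoc_logShift_iff`, `…_snoc_phaseShift_iff`, `…_piGamma_iff`), open inside B3;
`channelCount_summary`.  (+ gen-≤10 helpers never landed before: `isAlgebraic_I_rat`, `kleinIH_one`, `polar_rank_one_trdeg_ge_one`, `piGamma` cell facts.)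
§ Gen 11 of lens 4's ChannelCount.lean (705da1e0…); `--supports stmt-Schanuel-32408`.  Sorry-free; standard axioms; rung 0.
[cite: GelfondSchneider1934] [cite: BakerTNT1975, Ch. 2] [cite: Waldschmidt2000, §1.4]
-/

open Complex IntermediateField
open Literature.NumberTheory.Transcendental (trdeg_adjoin_le_of_le isAlgebraic_adjoin_over_algebraAdjoin nesterenko algebraicIndependent_exp_holds transcendental_pi_holds)

namespace Summit.Schanuel.Schanuel.Theorems.RootDecomp1BChannelCount

set_option linter.dupNamespace false

open Summit.Schanuel.Schanuel.Theses.RootDecomp1B (FreeSideCoupling KleinPolarSchanuel LocalSurplusBudget NoWildAbsorbingSlackFirstFailure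
  SharpRelativeLindemann TameDefectZeroStep TameSurplusOneStep TightBudgetCoupling)
open Summit.Schanuel.Schanuel.Theorems.RootDecomp1BFedFlagCore (KleinIH gens_mono polarDeg polarField polarGens)
open Summit.Schanuel.Schanuel.Theorems.RootDecomp1BTameFlagCore (LastTame lastTame_of_lastFed)
open Summit.Schanuel.Schanuel.Theorems.RootDecomp1BDefectFloorCells (algebraicIndependent_piExpPiGamma floor_snoc_exp linearIndependent_snoc_exp
  piGamma polarDeg_fin_zero polarDeg_pi_le_two range_real_subset_polar sharp_init_snoc_exp three_le_polarDeg_piGamma)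
open Summit.Schanuel.Schanuel.Theorems.RootDecomp1BDefectFloorChannels (coordinate_transcendental_piGamma coordinate_transcendental_snoc_exp
  floor_snoc_logShift floor_snoc_phaseShift init_piGamma logShift_cell_hypotheses modulus_transcendental_snoc_logShift phaseShift_cell_hypotheses
  phase_transcendental_snoc_phaseShift)

section

variable {m : ℕ}

/-- (private: print-twin of `MinimalCounterexampleInAcl.Negative.trdeg_adjoin_mono`, gate dedup) (gen-≤10 declaration of the node, never landed before; included by dependency closure) Monotonicity of transcendence degree under inclusion of generators. [folklore] -/
private theorem trdeg_adjoin_mono {S T : Set ℂ} (h : S ⊆ T) :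
    Algebra.trdeg ℚ ↥(IntermediateField.adjoin ℚ S) ≤ Algebra.trdeg ℚ ↥(IntermediateField.adjoin ℚ T) :=
  trdeg_le_of_injective (IntermediateField.inclusion (IntermediateField.adjoin.mono ℚ S T h))
    (IntermediateField.inclusion_injective _)

/-- (gen-≤10 declaration of the node, never landed before; included by dependency closure) `ℝ ↪ ℂ` preserves `ℚ`-linear independence of real tuples. -/
theorem linearIndependent_ofReal {m : ℕ} {r : Fin m → ℝ} (hr : LinearIndependent ℚ r) :
    LinearIndependent ℚ (fun j => ((r j : ℝ) : ℂ)) := by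
  rw [Fintype.linearIndependent_iff] at hr ⊢
  intro c hc
  apply hr
  have hsum : (((∑ j, c j • r j : ℝ) : ℂ)) = ∑ j, c j • ((r j : ℝ) : ℂ) := by
    rw [Complex.ofReal_sum]
    refine Finset.sum_congr rfl fun j _ => ?_
    rw [Rat.smul_def, Rat.smul_def, Complex.ofReal_mul, Complex.ofReal_ratCast]
  rw [hc] at hsum
  exact_mod_cast hsum

/-- (private: print-twin of `Literature.NumberTheory.Transcendental.KoblitzOgus.isAlgebraic_I`, gate dedup) (gen-≤10 declaration of the node, never landed before; included by dependency closure) `i` is algebraic over `ℚ` … -/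
private theorem isAlgebraic_I_rat : IsAlgebraic ℚ Complex.I :=
  IsAlgebraic.of_pow two_pos (by rw [Complex.I_sq]; exact isAlgebraic_one.neg)

/-- (gen-≤10 declaration of the node, never landed before; included by dependency closure) `trdeg_ℚ ℚ(s, i s, e^s, e^{i s}) ≥ 1` for a nonzero real `s` (Hermite–Lindemann, tree). -/
theorem polar_rank_one_trdeg_ge_one (r : Fin 1 → ℝ) (hr : LinearIndependent ℚ r) :
    ((1 : ℕ) : Cardinal) ≤ Algebra.trdeg ℚ ↥(IntermediateField.adjoin ℚ
      (Set.range (Fin.append (fun j => ((r j : ℝ) : ℂ)) (fun j => ((r j : ℝ) : ℂ) * Complex.I)) ∪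
        Set.range (Complex.exp ∘ Fin.append (fun j => ((r j : ℝ) : ℂ)) (fun j => ((r j : ℝ) : ℂ) * Complex.I)))) :=
  (Literature.Transcend.schanuelRank_one_of_transcendental_exp
      Literature.NumberTheory.Transcendental.transcendental_exp_holds _ (linearIndependent_ofReal hr)).trans
    (trdeg_adjoin_mono (gens_mono (range_real_subset_polar r)))

/-- (gen-≤10 declaration of the node, never landed before; included by dependency closure) `KleinIH 1` holds (only the empty tuple is below length one). -/
theorem kleinIH_one : KleinIH 1 := by
  intro k hk s _
  have hk0 : k = 0 := by omega
  subst hk0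
  simp

/-- (gen-≤10 declaration of the node, never landed before; included by dependency closure) -/
theorem algebraicIndependent_piGamma (hN : nesterenko) : AlgebraicIndependent ℚ piGamma := by
  have h := (algebraicIndependent_piExpPiGamma hN).comp ![(0 : Fin 3), 2] (by decide)
  convert h using 1
  funext i
  fin_cases i <;> rfl

/-- (gen-≤10 declaration of the node, never landed before; included by dependency closure) -/
theorem linearIndependent_piGamma (hN : nesterenko) : LinearIndependent ℚ piGamma :=
  (algebraicIndependent_piGamma hN).linearIndependent

/-- (gen-≤10 declaration of the node, never landed before; included by dependency closure) … with BOTH structural hypotheses discharged: (π, Γ(1/4)) is `ℚ`-free and (π) is sharp.  X at (π, Γ(1/4)) —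
«t ≥ 4» — is OPEN: the cell lies outside the regime where X is known. -/
theorem piGamma_cell_hypotheses (hN : nesterenko) :
    LinearIndependent ℚ piGamma ∧ polarDeg (Fin.init piGamma) ≤ ((1 + 1 : ℕ) : Cardinal) :=
  ⟨linearIndependent_piGamma hN, by rw [init_piGamma]; exact_mod_cast polarDeg_pi_le_two⟩

/-- over the polar field of the EMPTY tuple (= ℚ) «algebraic» means algebraic over ℚ. -/
theorem isAlgebraic_rat_of_polarField_fin_zero (s : Fin 0 → ℝ) {x : ℂ} (hx : IsAlgebraic ↥(polarField s) x) :
    IsAlgebraic ℚ x := by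
  haveI : Algebra.IsAlgebraic ℚ ↥(polarField s) := by
    unfold polarField
    exact isAlgebraic_adjoin fun y hy => by
      simp only [polarGens, Set.mem_union, Set.mem_range] at hy
      rcases hy with ⟨i, -⟩ | ⟨i, -⟩ <;> exact Fin.elim0 i
  exact hx.restrictScalars ℚ

/-- `i ∉ ℚ`. -/
theorem I_not_mem_range_ratCast : Complex.I ∉ Set.range ((↑) : ℚ → ℂ) := by
  rintro ⟨q, hq⟩
  have h := congrArg Complex.im hq
  simp at h

/-- THE TRANSCENDENCE INPUT NEW TO THE ROUTE: for a real `u ≠ 0`, AT MOST ONE of `u, e^u, e^{iu}` is algebraic over ℚ —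
the pairs (u, e^u), (u, e^{iu}) by HERMITE–LINDEMANN (`transcendental_exp_holds`: `e^α ∉ ℚ̄` for algebraic `α ≠ 0`, with
`α = u`, resp. `α = iu`), the pair (e^u, e^{iu}) by GELFOND–SCHNEIDER (`gelfond_schneider_holds` with `a = e^u`
algebraic, `b = i` algebraic irrational, `l = u ≠ 0`, `e^l = a`: `e^{bl} = e^{iu} = a^i ∉ ℚ̄`). -/
theorem atMostOne_algebraic_channel (u : ℝ) (hu : u ≠ 0) :
    ¬ (IsAlgebraic ℚ ((u : ℝ) : ℂ) ∧ IsAlgebraic ℚ (Complex.exp ((u : ℝ) : ℂ))) ∧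
      ¬ (IsAlgebraic ℚ ((u : ℝ) : ℂ) ∧ IsAlgebraic ℚ (Complex.exp (((u : ℝ) : ℂ) * Complex.I))) ∧
      ¬ (IsAlgebraic ℚ (Complex.exp ((u : ℝ) : ℂ)) ∧ IsAlgebraic ℚ (Complex.exp (((u : ℝ) : ℂ) * Complex.I))) := by
  have hu' : ((u : ℝ) : ℂ) ≠ 0 := Complex.ofReal_ne_zero.mpr hu
  refine ⟨fun h => ?_, fun h => ?_, fun h => ?_⟩
  · exact Literature.NumberTheory.Transcendental.transcendental_exp_holds h.1 hu' h.2
  · exact Literature.NumberTheory.Transcendental.transcendental_exp_holds (h.1.mul isAlgebraic_I_rat)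
      (mul_ne_zero hu' Complex.I_ne_zero) h.2
  · have hGS : Transcendental ℚ (Complex.exp (Complex.I * ((u : ℝ) : ℂ))) :=
      Literature.NumberTheory.Transcendental.gelfond_schneider_holds h.1 isAlgebraic_I_rat I_not_mem_range_ratCast
        rfl hu'
    rw [mul_comm] at hGS
    exact hGS h.2

/-- LAYER 0 of `AtMostOneClosed`: for a length-one tuple with `u ≠ 0` it HOLDS. -/
theorem atMostOneClosed_zero (r : Fin 1 → ℝ) (hu : r (Fin.last 0) ≠ 0) : AtMostOneClosed 0 r := by
  have h := atMostOne_algebraic_channel (r (Fin.last 0)) hu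
  rw [atMostOneClosed_iff]
  exact ⟨fun hc => h.1 ⟨isAlgebraic_rat_of_polarField_fin_zero _ hc.1, isAlgebraic_rat_of_polarField_fin_zero _ hc.2⟩,
    fun hc => h.2.1 ⟨isAlgebraic_rat_of_polarField_fin_zero _ hc.1, isAlgebraic_rat_of_polarField_fin_zero _ hc.2⟩,
    fun hc => h.2.2 ⟨isAlgebraic_rat_of_polarField_fin_zero _ hc.1, isAlgebraic_rat_of_polarField_fin_zero _ hc.2⟩⟩

/-- ★ LAYER 0 OF THE SECOND CHANNEL IS A THEOREM, HYPOTHESIS-FREE: `SharpSecondChannelAt 0 r` for EVERY `r` — by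
Hermite–Lindemann and GELFOND–SCHNEIDER.  It is decided throughout X's OPEN regime at length one (X(1) at `u`:
«t(u) ≥ 2», open at log 2, at Ω, …). -/
theorem sharpSecondChannelAt_zero (r : Fin 1 → ℝ) : SharpSecondChannelAt 0 r :=
  fun hr _ _ _ => atMostOneClosed_zero r (hr.ne_zero (Fin.last 0))

/-- … so at length one JI reads EXACTLY X(1): «t(u) ≥ 2 for the ℚ-free (= nonzero) real u» … -/
theorem twoChannelDefectZeroAt_zero_iff (r : Fin 1 → ℝ) :
    TwoChannelDefectZeroAt 0 r ↔ (LinearIndependent ℚ r → ((2 : ℕ) : Cardinal) ≤ polarDeg r) := by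
  have h0 : polarDeg (Fin.init r) ≤ ((0 + 0 : ℕ) : Cardinal) := by
    rw [polarDeg_fin_zero]
    exact bot_le
  constructor
  · intro h hr
    exact_mod_cast h hr kleinIH_one h0 (atMostOneClosed_zero r (hr.ne_zero (Fin.last 0)))
  · intro h hr _ _ _
    exact_mod_cast h hr

/-- … and so does SD0 (its floor hypothesis `t(u) ≥ 1` is Hermite–Lindemann's, `polar_rank_one_trdeg_ge_one`). -/
theorem sharpDefectZeroAt_zero_iff (r : Fin 1 → ℝ) :
    SharpDefectZeroAt 0 r ↔ (LinearIndependent ℚ r → ((2 : ℕ) : Cardinal) ≤ polarDeg r) := by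
  have h0 : polarDeg (Fin.init r) ≤ ((0 + 0 : ℕ) : Cardinal) := by
    rw [polarDeg_fin_zero]
    exact bot_le
  constructor
  · intro h hr
    exact_mod_cast h hr kleinIH_one h0 (by exact_mod_cast polar_rank_one_trdeg_ge_one r hr)
  · intro h hr _ _ _
    exact_mod_cast h hr

/-- THE DECIDED CELL IN X's OPEN REGIME, channel by channel: at `u = log α` (α > 0 algebraic, α ≠ 1 — a TAME real, the
MODULUS channel `e^u = α` CLOSED) the COORDINATE channel is open by Hermite–Lindemann and the PHASE channel
`e^{iu} = α^i` is open by GELFOND–SCHNEIDER; X(1) there («log α and α^i algebraically independent») is OPEN. -/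
theorem channels_log_algebraic (α : ℝ) (hα : IsAlgebraic ℚ ((α : ℝ) : ℂ)) (hpos : 0 < α) (hα1 : α ≠ 1) :
    Transcendental ℚ ((Real.log α : ℝ) : ℂ) ∧ IsAlgebraic ℚ (Complex.exp ((Real.log α : ℝ) : ℂ)) ∧
      Transcendental ℚ (Complex.exp (((Real.log α : ℝ) : ℂ) * Complex.I)) := by
  have hexp : Complex.exp ((Real.log α : ℝ) : ℂ) = ((α : ℝ) : ℂ) := by
    rw [← Complex.ofReal_exp, Real.exp_log hpos]
  have hmod : IsAlgebraic ℚ (Complex.exp ((Real.log α : ℝ) : ℂ)) := by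
    rw [hexp]
    exact hα
  have h := atMostOne_algebraic_channel (Real.log α) (Real.log_ne_zero_of_pos_of_ne_one hpos hα1)
  exact ⟨fun hl => h.1 ⟨hl, hmod⟩, hmod, fun hp => h.2.2 ⟨hmod, hp⟩⟩

/-- (log α) is a TAME length-one tuple (its modulus channel is closed: `LastFed`, hence `LastTame`) — the cell sits in
T0's column, where T0(0) = X(1) at log α is OPEN while TC(0) is decided. -/
theorem lastTame_log_algebraic (α : ℝ) (hα : IsAlgebraic ℚ ((α : ℝ) : ℂ)) (hpos : 0 < α) :
    LastTame 0 ![Real.log α] := by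
  refine lastTame_of_lastFed (Or.inl ?_)
  have hlast : ![Real.log α] (Fin.last 0) = Real.log α := rfl
  rw [hlast, ← Complex.ofReal_exp, Real.exp_log hpos]
  exact hα.tower_top _

/-- With the structural hypotheses discharged, the TC-cell is «KleinIH → at most one closed channel». -/
theorem sharpSecondChannelAt_iff_of_hypotheses {r : Fin (m + 1) → ℝ} (hr : LinearIndependent ℚ r)
    (hle : polarDeg (Fin.init r) ≤ ((m + m : ℕ) : Cardinal)) (hfl : ((m + m + 1 : ℕ) : Cardinal) ≤ polarDeg r) :
    SharpSecondChannelAt m r ↔ (KleinIH (m + 1) → AtMostOneClosed m r) :=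
  ⟨fun h hIH => h hr hIH hle hfl, fun h _ hIH _ _ => h hIH⟩

/-- `AtMostOneClosed` on a `Fin.snoc` tuple, in pairs form over `F(β)`. -/
theorem atMostOneClosed_snoc_iff (β : Fin m → ℝ) (x : ℝ) :
    AtMostOneClosed m (Fin.snoc β x : Fin (m + 1) → ℝ) ↔
      (¬ (IsAlgebraic ↥(polarField β) ((x : ℝ) : ℂ) ∧ IsAlgebraic ↥(polarField β) (Complex.exp ((x : ℝ) : ℂ))) ∧
        ¬ (IsAlgebraic ↥(polarField β) ((x : ℝ) : ℂ) ∧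
          IsAlgebraic ↥(polarField β) (Complex.exp (((x : ℝ) : ℂ) * Complex.I))) ∧
        ¬ (IsAlgebraic ↥(polarField β) (Complex.exp ((x : ℝ) : ℂ)) ∧
          IsAlgebraic ↥(polarField β) (Complex.exp (((x : ℝ) : ℂ) * Complex.I)))) := by
  rw [atMostOneClosed_iff, Fin.init_snoc]
  simp only [Fin.snoc_last]

/-- TC on the LINDEMANN–WEIERSTRASS FAMILY (β | e^γ) (floor DECIDED `floor_snoc_exp`, (β) CERTIFIED sharp, tuple
certified ℚ-free, COORDINATE channel e^γ CERTIFIED open `coordinate_transcendental_snoc_exp`) reads EXACTLY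
«KleinIH (m+1) → e^{e^γ}, e^{ie^γ} NOT BOTH algebraic over F(β)» — relative GELFOND–SCHNEIDER over a field of
transcendence degree 2m (flagship (√2 | e): «e^e, e^{ie} not both in acl ℚ(e, e^{√2}, e^{i√2})»): OPEN for m ≥ 1. -/
theorem sharpSecondChannelAt_snoc_exp_iff (β : Fin m → ℝ) (γ : ℝ) (hβ : ∀ j, IsAlgebraic ℚ ((β j : ℝ) : ℂ))
    (hγ : IsAlgebraic ℚ ((γ : ℝ) : ℂ)) (hli : LinearIndependent ℚ (Fin.snoc β γ : Fin (m + 1) → ℝ)) :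
    SharpSecondChannelAt m (Fin.snoc β (Real.exp γ) : Fin (m + 1) → ℝ) ↔
      (KleinIH (m + 1) →
        ¬ (IsAlgebraic ↥(polarField β) (Complex.exp ((Real.exp γ : ℝ) : ℂ)) ∧
            IsAlgebraic ↥(polarField β) (Complex.exp (((Real.exp γ : ℝ) : ℂ) * Complex.I)))) := by
  rw [sharpSecondChannelAt_iff_of_hypotheses (linearIndependent_snoc_exp β γ hβ hγ hli) (sharp_init_snoc_exp β γ hβ)
    (floor_snoc_exp β γ hβ hγ hli), atMostOneClosed_snoc_iff]
  have hu := coordinate_transcendental_snoc_exp β γ hβ hγ hli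
  exact ⟨fun h hIH => (h hIH).2.2, fun h hIH => ⟨fun hc => hu hc.1, fun hc => hu hc.1, h hIH⟩⟩

/-- TC on the LOGARITHMIC SHIFTS (β | γ + log α) (floor decided `floor_snoc_logShift`, MODULUS channel α e^γ certified
open `modulus_transcendental_snoc_logShift`) reads EXACTLY «KleinIH (m+1) → γ + log α, e^{i(γ + log α)} NOT BOTH
algebraic over F(β)»: OPEN. -/
theorem sharpSecondChannelAt_snoc_logShift_iff (β : Fin m → ℝ) (γ α : ℝ) (hβ : ∀ j, IsAlgebraic ℚ ((β j : ℝ) : ℂ))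
    (hγ : IsAlgebraic ℚ ((γ : ℝ) : ℂ)) (hα : IsAlgebraic ℚ ((α : ℝ) : ℂ)) (hα0 : 0 < α)
    (hli : LinearIndependent ℚ (Fin.snoc β γ : Fin (m + 1) → ℝ)) :
    SharpSecondChannelAt m (Fin.snoc β (γ + Real.log α) : Fin (m + 1) → ℝ) ↔
      (KleinIH (m + 1) →
        ¬ (IsAlgebraic ↥(polarField β) ((γ + Real.log α : ℝ) : ℂ) ∧
            IsAlgebraic ↥(polarField β) (Complex.exp (((γ + Real.log α : ℝ) : ℂ) * Complex.I)))) := by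
  rw [sharpSecondChannelAt_iff_of_hypotheses (logShift_cell_hypotheses β γ α hβ hγ hα hα0 hli).1
    (logShift_cell_hypotheses β γ α hβ hγ hα hα0 hli).2 (floor_snoc_logShift β γ α hβ hγ hα hα0 hli),
    atMostOneClosed_snoc_iff]
  have hE := modulus_transcendental_snoc_logShift β γ α hβ hγ hα hα0 hli
  exact ⟨fun h hIH => (h hIH).2.1, fun h hIH => ⟨fun hc => hE hc.2, h hIH, fun hc => hE hc.1⟩⟩

/-- TC on the RATIONAL ROTATIONS (β | γ + qπ) (floor decided `floor_snoc_phaseShift`, PHASE channel certified open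
`phase_transcendental_snoc_phaseShift`) reads EXACTLY «KleinIH (m+1) → γ + qπ, e^{γ + qπ} NOT BOTH algebraic over
F(β)»: OPEN (∋ «π ∉ acl ℚ(e^β, e^{iβ})»-type statements). -/
theorem sharpSecondChannelAt_snoc_phaseShift_iff (β : Fin m → ℝ) (γ : ℝ) (q : ℚ)
    (hβ : ∀ j, IsAlgebraic ℚ ((β j : ℝ) : ℂ)) (hγ : IsAlgebraic ℚ ((γ : ℝ) : ℂ))
    (hli : LinearIndependent ℚ (Fin.snoc β γ : Fin (m + 1) → ℝ)) :
    SharpSecondChannelAt m (Fin.snoc β (γ + q * Real.pi) : Fin (m + 1) → ℝ) ↔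
      (KleinIH (m + 1) →
        ¬ (IsAlgebraic ↥(polarField β) ((γ + q * Real.pi : ℝ) : ℂ) ∧
            IsAlgebraic ↥(polarField β) (Complex.exp ((γ + q * Real.pi : ℝ) : ℂ)))) := by
  rw [sharpSecondChannelAt_iff_of_hypotheses (phaseShift_cell_hypotheses β γ q hβ hγ hli).1
    (phaseShift_cell_hypotheses β γ q hβ hγ hli).2 (floor_snoc_phaseShift β γ q hβ hγ hli), atMostOneClosed_snoc_iff]
  have hE := phase_transcendental_snoc_phaseShift β γ q hβ hγ hli
  exact ⟨fun h hIH => (h hIH).1, fun h hIH => ⟨h hIH, fun hc => hE hc.2, fun hc => hE hc.2⟩⟩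

/-- At the NESTERENKO FLAG (π | Γ(1/4)) (floor decided `three_le_polarDeg_piGamma`, (π) certified sharp, COORDINATE channel
Γ(1/4) certified open over F(π) `coordinate_transcendental_piGamma`) the TC-cell reads — given Nesterenko — EXACTLY
«KleinIH 2 → e^{Γ(1/4)}, e^{iΓ(1/4)} NOT BOTH algebraic over F(π)»: OPEN (X there asks for both). -/
theorem sharpSecondChannelAt_piGamma_iff (hN : nesterenko) :
    SharpSecondChannelAt 1 piGamma ↔
      (KleinIH 2 →
        ¬ (IsAlgebraic ↥(polarField ![Real.pi]) (Complex.exp ((Real.Gamma (1 / 4) : ℝ) : ℂ)) ∧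
            IsAlgebraic ↥(polarField ![Real.pi]) (Complex.exp (((Real.Gamma (1 / 4) : ℝ) : ℂ) * Complex.I)))) := by
  rw [sharpSecondChannelAt_iff_of_hypotheses (linearIndependent_piGamma hN) (piGamma_cell_hypotheses hN).2
      (by exact_mod_cast three_le_polarDeg_piGamma hN),
    imp_congr_right fun _ => atMostOneClosed_iff_of_transcendental_coordinate (coordinate_transcendental_piGamma hN)]
  rw [init_piGamma]
  exact Iff.rfl

/-- GEN-11 SURFACE, packaged: (i) layer 0 of TC is a theorem; (ii) SD0 ⟺ TC ∧ JI; (iii) the binders of PATH F″ and of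
PATH F are each equivalent to X beneath the EQUIV layer. -/
theorem channelCount_summary :
    (∀ r : Fin 1 → ℝ, SharpSecondChannelAt 0 r) ∧
      (SharpDefectZeroStep ↔ (SharpSecondChannel ∧ TwoChannelDefectZeroStep)) ∧
      (KleinPolarSchanuel ↔ (LocalSurplusBudget ∧ FreeSideCoupling ∧ TightBudgetCoupling ∧ SharpRelativeLindemann ∧
        TameDefectZeroStep ∧ SharpDefectZeroStep ∧ NoWildAbsorbingSlackFirstFailure)) ∧
      (KleinPolarSchanuel ↔ (LocalSurplusBudget ∧ FreeSideCoupling ∧ TightBudgetCoupling ∧ SharpRelativeLindemann ∧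
        SharpDefectZeroStep ∧ TameSurplusOneStep ∧ NoWildAbsorbingSlackFirstFailure)) :=
  ⟨sharpSecondChannelAt_zero, sharpDefectZeroStep_iff_channels, kleinPolarSchanuel_iff_pieces11,
    kleinPolarSchanuel_iff_pieces11T⟩

end

end Summit.Schanuel.Schanuel.Theorems.RootDecomp1BChannelCount
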